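import Summits.Parity.BatemanHorn.Theorems.AlmostPrimeZerosSystemLSDRealSegmentNairEngine
import Summits.Parity.BatemanHorn.Theorems.AlmostPrimeZerosSystemLSDRealSegmentNairRankin
import Summits.Parity.BatemanHorn.Theorems.AlmostPrimeZerosSystemLSDRealSegmentNairCut
import HarnessLib

/-!
# Nair–Tenenbaum light, VIII: the `c`-sum through the engine and class I

Crux `SystemLSDRealSegment` (stmt-Parity-11292, route `AlmostPrimeZeros`), line `beta-thinned-root-kernel`,
support programme of the lead c8: **Nair–Tenenbaum "light"** — the sharp-order upper bound
`Σ_{1≤n≤N} G(F(n)) ≤ C · N · exp(Σ_{p≤N} (G(p) − 1) ρ_F(p)/p)` for a polynomial `F ∈ ℤ[X]` (degree `≥ 1`, positive on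
`ℕ_{≥1}`, root counts `ρ_F(p) ≤ D`, `ρ_F(p) < p`, `ρ_F(p^a) ≤ M`) and every weight `G ≥ 0`, `G(1) = 1`, multiplicative on
coprime arguments with `G(p^v) ≤ A` (M. Nair, Acta Arith. 62 (1992); Nair–Tenenbaum, Acta Math. 180 (1998), Thm 1 —
the special case of the class bounded at prime powers), by Shiu's method (J. reine angew. Math. 313 (1980), §5) run on the
values `m = F(n)`: cut `m = c·d` at `√N` (`Shiu.cutPrime/cPart/dPart`), four classes, the beta upper-bound sieve of dimension
`2D` on the root classes of `c`, Hall–Tenenbaum's Theorem 01 and Rankin's trick with a uniform exponent for the `c`-sums.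
Applied (file `…NairUpperBound`) to the product polynomial of a Bateman–Horn system with `G = y^{capped}` it gives
`Σ_{n≤x} y^{s_f(n)} ≪ x (log x)^{k(y−1)}`, i.e. `H_x(y) = O(1)` on the real segment — the upper half of the order of
magnitude predicted by the crux (lower half: `sumPowStat_lower_bound`, landed).  Everything here is PROVED; no definitions.

This file: `csum_le` (engine + `V(w)h(c)` + the `G·ρ` mean) and `class1_le` (cut prime `≥ N^{c₀}`: `≤ C N exp(Σ (G−1)ρ/p)`).
-/

open Finset Real Polynomial

namespace Summit.Parity.BatemanHorn.Cruxes.SystemLSDRealSegment.BetaThinnedRootKernel.Nair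

open Literature.NumberTheory.Sieve

noncomputable section

section Main

variable {F : ℤ[X]} {D M : ℕ} {A : ℝ}

/-- **The `c`-sum through the engine.** For `Cset ⊆ [1, √N]`, `2 ≤ w ≤ N`:
`Σ_{c ∈ Cset} G(c) · #{n ≤ N : c ∣ F(n), (F(n), P_c(w)) = 1} ≤ K₁ N V(w) Σ_{c ∈ Cset} u(c)/c + K₂ w^{18D+1}(log w)^D √N e^{AM + AD(log log N + 4)}`.
[folklore] -/
theorem csum_le (hpos : ∀ n : ℕ, 1 ≤ n → 0 < F.eval (n : ℤ))
    (hD : ∀ p : ℕ, p.Prime → polyRootCountMod ![F] p ≤ D) (hD1 : 1 ≤ D)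
    (hfix : ∀ p : ℕ, p.Prime → polyRootCountMod ![F] p < p)
    (hM : ∀ p : ℕ, p.Prime → ∀ a : ℕ, 1 ≤ a → polyRootCountMod ![F] (p ^ a) ≤ M) (hM1 : 1 ≤ M) (hA : 1 ≤ A) :
    ∃ K₁ K₂ : ℝ, 0 < K₁ ∧ 0 < K₂ ∧ ∀ G : ℕ → ℝ, (∀ n, 0 ≤ G n) → G 1 = 1 →
      (∀ m n : ℕ, m.Coprime n → G (m * n) = G m * G n) →
      (∀ p : ℕ, p.Prime → ∀ v : ℕ, 1 ≤ v → G (p ^ v) ≤ A) →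
      ∀ N : ℕ, 4 ≤ N → ∀ w : ℝ, 2 ≤ w → w ≤ N → ∀ Cset : Finset ℕ, Cset ⊆ Icc 1 ⌊Real.sqrt N⌋₊ →
        ∑ c ∈ Cset, G c * #((Icc 1 N).filter fun n : ℕ => (c : ℤ) ∣ F.eval (n : ℤ) ∧
            ∀ p ∈ Nat.primesBelow ⌈w⌉₊, ¬ p ∣ c → ¬ (p : ℤ) ∣ F.eval (n : ℤ)) ≤
          K₁ * N * (∏ p ∈ Nat.primesBelow ⌈w⌉₊, (1 - (polyRootCountMod ![F] p : ℝ) / p)) *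
              ∑ c ∈ Cset, G c * polyRootCountMod ![F] c *
                (∏ p ∈ c.primeFactors, (p : ℝ) / ((p : ℝ) - polyRootCountMod ![F] p)) / c +
            K₂ * w ^ (18 * D + 1) * Real.log w ^ D *
              (Real.sqrt N * Real.exp (A * M + A * D * (Real.log (Real.log N) + 4))) := by
  obtain ⟨K₁, K₂, hK₁, hK₂, hEng⟩ := engine F hD hD1 hfix
  refine ⟨K₁, K₂, hK₁, hK₂, ?_⟩
  intro G hG0 hG1 hGmul hGA N hN w hw hwN Cset hCset
  set V : ℝ := ∏ p ∈ Nat.primesBelow ⌈w⌉₊, (1 - (polyRootCountMod ![F] p : ℝ) / p) with hVdef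
  have hN1 : (1 : ℝ) ≤ N := by exact_mod_cast (show 1 ≤ N by omega)
  have hposN : ∀ n : ℕ, 1 ≤ n → n ≤ N → 0 < F.eval (n : ℤ) := fun n hn _ => hpos n hn
  -- termwise
  have hterm : ∀ c ∈ Cset,
      G c * #((Icc 1 N).filter fun n : ℕ => (c : ℤ) ∣ F.eval (n : ℤ) ∧
          ∀ p ∈ Nat.primesBelow ⌈w⌉₊, ¬ p ∣ c → ¬ (p : ℤ) ∣ F.eval (n : ℤ)) ≤
        K₁ * N * V * (G c * polyRootCountMod ![F] c *
          (∏ p ∈ c.primeFactors, (p : ℝ) / ((p : ℝ) - polyRootCountMod ![F] p)) / c) +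
        K₂ * w ^ (18 * D + 1) * Real.log w ^ D * (G c * polyRootCountMod ![F] c) := by
    intro c hc
    have hc1 : 1 ≤ c := (Finset.mem_Icc.1 (hCset hc)).1
    have hc0 : c ≠ 0 := by omega
    have h1 := hEng N c hc1 w hw hposN
    have h2 := prod_filter_not_dvd_le F hD hfix hc0 w
    have hG := hG0 c
    have hρ : (0 : ℝ) ≤ polyRootCountMod ![F] c := Nat.cast_nonneg _
    have hV0 : 0 ≤ V := Finset.prod_nonneg fun p hp => by
      have hpp := (Nat.mem_primesBelow.1 hp).2
      have : (polyRootCountMod ![F] p : ℝ) < p := by exact_mod_cast hfix p hpp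
      have hp0 : (0 : ℝ) < p := by exact_mod_cast hpp.pos
      rw [sub_nonneg, div_le_one hp0]; exact this.le
    have hNc : (0 : ℝ) ≤ (N : ℝ) / c := by positivity
    calc G c * #((Icc 1 N).filter fun n : ℕ => (c : ℤ) ∣ F.eval (n : ℤ) ∧
            ∀ p ∈ Nat.primesBelow ⌈w⌉₊, ¬ p ∣ c → ¬ (p : ℤ) ∣ F.eval (n : ℤ))
        ≤ G c * (K₁ * ((N : ℝ) / c) * polyRootCountMod ![F] c *
            ∏ p ∈ (Nat.primesBelow ⌈w⌉₊).filter (fun p => ¬ p ∣ c), (1 - (polyRootCountMod ![F] p : ℝ) / p) +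
          K₂ * polyRootCountMod ![F] c * w ^ (18 * D + 1) * Real.log w ^ D) :=
          mul_le_mul_of_nonneg_left h1 hG
      _ ≤ G c * (K₁ * ((N : ℝ) / c) * polyRootCountMod ![F] c *
            (V * ∏ p ∈ c.primeFactors, (p : ℝ) / ((p : ℝ) - polyRootCountMod ![F] p)) +
          K₂ * polyRootCountMod ![F] c * w ^ (18 * D + 1) * Real.log w ^ D) := by
          gcongr
      _ = _ := by ring
  refine (Finset.sum_le_sum hterm).trans ?_
  rw [Finset.sum_add_distrib, ← Finset.mul_sum, ← Finset.mul_sum]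
  gcongr
  · -- `0 ≤ K₂ w^E (log w)^D`
    have : 0 ≤ Real.log w := Real.log_nonneg (by linarith)
    positivity
  · -- `Σ_{Cset} G ρ ≤ √N exp(…)`
    have hZ2 : 2 ≤ ⌊Real.sqrt N⌋₊ := by
      refine Nat.le_floor ?_
      rw [show ((2 : ℕ) : ℝ) = Real.sqrt 4 by
        rw [show (4 : ℝ) = 2 ^ 2 by norm_num, Real.sqrt_sq (by norm_num)]; norm_num]
      exact Real.sqrt_le_sqrt (by exact_mod_cast hN)
    have h1 := sum_Grho_le F hD hM hM1 hG0 hG1 hGmul hGA hA hZ2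
    have h2 : ∑ c ∈ Cset, G c * polyRootCountMod ![F] c ≤
        ∑ c ∈ Icc 1 ⌊Real.sqrt N⌋₊, G c * polyRootCountMod ![F] c :=
      Finset.sum_le_sum_of_subset_of_nonneg hCset fun c _ _ => mul_nonneg (hG0 c) (Nat.cast_nonneg _)
    refine h2.trans (h1.trans ?_)
    have hsq : (⌊Real.sqrt N⌋₊ : ℝ) ≤ Real.sqrt N := Nat.floor_le (Real.sqrt_nonneg _)
    have hsq1 : (1 : ℝ) < ⌊Real.sqrt N⌋₊ := by exact_mod_cast (show 1 < ⌊Real.sqrt N⌋₊ by omega)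
    have hsqN : Real.sqrt N ≤ N := by rw [Real.sqrt_le_left (by linarith)]; nlinarith
    have hll : Real.log (Real.log ⌊Real.sqrt N⌋₊) ≤ Real.log (Real.log N) := by
      refine Real.log_le_log (Real.log_pos hsq1) (Real.log_le_log (by linarith) (hsq.trans hsqN))
    have hD0 : (0 : ℝ) ≤ A * D := by have : (0:ℝ) ≤ D := Nat.cast_nonneg _; nlinarith
    gcongr

set_option maxHeartbeats 400000 in
/-- **Class I** (`P ≥ N^{c₀}`: the cofactor has boundedly many prime factors; sieve by all primes `< N^{c₀}`):
`Σ ≤ C N exp(Σ_{p ≤ N} (G(p) − 1)ρ(p)/p)`. [folklore] -/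
theorem class1_le (hd : 1 ≤ F.natDegree) (hpos : ∀ n : ℕ, 1 ≤ n → 0 < F.eval (n : ℤ))
    (hD : ∀ p : ℕ, p.Prime → polyRootCountMod ![F] p ≤ D) (hD1 : 1 ≤ D)
    (hfix : ∀ p : ℕ, p.Prime → polyRootCountMod ![F] p < p)
    (hM : ∀ p : ℕ, p.Prime → ∀ a : ℕ, 1 ≤ a → polyRootCountMod ![F] (p ^ a) ≤ M) (hM1 : 1 ≤ M) (hA : 1 ≤ A) :
    ∃ C : ℝ, 0 < C ∧ ∃ N₀ : ℕ, ∀ G : ℕ → ℝ, (∀ n, 0 ≤ G n) → G 1 = 1 →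
      (∀ m n : ℕ, m.Coprime n → G (m * n) = G m * G n) →
      (∀ p : ℕ, p.Prime → ∀ v : ℕ, 1 ≤ v → G (p ^ v) ≤ A) →
      ∀ N : ℕ, N₀ ≤ N →
        ∑ n ∈ (Icc 1 N).filter (fun n : ℕ => Real.sqrt N < (F.eval (n : ℤ)).toNat ∧
              (N : ℝ) ^ (1 / (4 * (18 * (D : ℝ) + 1))) ≤ (Shiu.cutPrime (Real.sqrt N) (F.eval (n : ℤ)).toNat : ℝ)),
            G (F.eval (n : ℤ)).toNat ≤
          C * N * Real.exp (∑ p ∈ Nat.primesLE N, (G p - 1) * polyRootCountMod ![F] p / p) := by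
  obtain ⟨K₁, K₂, hK₁, hK₂, hcs⟩ := csum_le hpos hD hD1 hfix hM hM1 hA
  obtain ⟨K₅, hK₅, hV⟩ := densityProd_le F hD hfix
  set d := F.natDegree with hddef
  set Hh : ℕ := ∑ j ∈ range (F.natDegree + 1), (F.coeff j).natAbs with hHh
  have hH1 : 1 ≤ Hh := one_le_height hd
  set e₀ : ℝ := 1 / (4 * (18 * (D : ℝ) + 1)) with he₀
  have hD0 : (0 : ℝ) < 18 * (D : ℝ) + 1 := by positivity
  have he₀0 : 0 < e₀ := by rw [he₀]; positivity
  have he₀1 : e₀ ≤ 1 / 4 := by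
    rw [he₀, div_le_div_iff₀ (by positivity) (by norm_num), one_mul, one_mul]
    have : (1 : ℝ) ≤ D := by exact_mod_cast hD1
    nlinarith
  set B₂ : ℝ := ((d : ℝ) + 1) / e₀ with hB₂
  have hB₂0 : 0 ≤ B₂ := by rw [hB₂]; positivity
  set Kc : ℝ := A * M * (4 * D + 2) + A * (4 * D + 2) * D ^ 2 with hKc
  set Bℓ : ℝ := 2 * D + A * D with hBℓ
  have hBℓ0 : 0 ≤ Bℓ := by rw [hBℓ]; have : (0:ℝ) ≤ D := Nat.cast_nonneg _; nlinarith
  set C₁ : ℝ := A ^ B₂ * K₁ * K₅ * (1 / e₀) ^ D * Real.exp Kc with hC₁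
  set C₂ : ℝ := A ^ B₂ * K₂ * Real.exp (A * M + A * D * 4) * Real.exp (4 * D) *
      Real.exp (Bℓ * Real.log (Bℓ / (1 / 4) + 1)) with hC₂
  have hApos : 0 < A ^ B₂ := Real.rpow_pos_of_pos (by linarith) _
  -- threshold: `z₀ = N^{e₀} ≥ 2`, `N ≥ Hh 2^d`, `N ≥ 4`
  obtain ⟨N₀, hN₀⟩ : ∃ N₀ : ℕ, ∀ N : ℕ, N₀ ≤ N → (2 : ℝ) ≤ (N : ℝ) ^ e₀ ∧ Hh * 2 ^ d ≤ N ∧ 4 ≤ N := by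
    refine ⟨max (⌈(2 : ℝ) ^ (1 / e₀)⌉₊) (max (Hh * 2 ^ d) 4), fun N hN => ⟨?_, ?_, ?_⟩⟩
    · have h1 : (2 : ℝ) ^ (1 / e₀) ≤ N := (Nat.le_ceil _).trans (by exact_mod_cast (le_max_left _ _).trans hN)
      calc (2 : ℝ) = ((2 : ℝ) ^ (1 / e₀)) ^ e₀ := by
            rw [← Real.rpow_mul (by norm_num), one_div, inv_mul_cancel₀ he₀0.ne', Real.rpow_one]
        _ ≤ (N : ℝ) ^ e₀ := Real.rpow_le_rpow (by positivity) h1 he₀0.le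
    · exact ((le_max_left _ _).trans (le_max_right _ _)).trans hN
    · exact ((le_max_right _ _).trans (le_max_right _ _)).trans hN
  refine ⟨C₁ + C₂, by positivity, N₀, ?_⟩
  intro G hG0 hG1 hGmul hGA N hN
  obtain ⟨hz2, hNH, hN4⟩ := hN₀ N hN
  set z₀ : ℝ := (N : ℝ) ^ e₀ with hz₀
  have hN1 : (1 : ℝ) < N := by exact_mod_cast (show 1 < N by omega)
  have hN0 : (0 : ℝ) < N := by linarith
  have hlogN : 0 < Real.log N := Real.log_pos hN1
  have hz₀N : z₀ ≤ N := by
    calc z₀ ≤ (N : ℝ) ^ (1 : ℝ) := Real.rpow_le_rpow_of_exponent_le hN1.le (by linarith)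
      _ = N := Real.rpow_one _
  have hlogz₀ : Real.log z₀ = e₀ * Real.log N := by rw [hz₀, Real.log_rpow hN0]
  have hlogz₀pos : 0 < Real.log z₀ := by rw [hlogz₀]; positivity
  set S := (Icc 1 N).filter (fun n : ℕ => Real.sqrt N < (F.eval (n : ℤ)).toNat ∧
      z₀ ≤ (Shiu.cutPrime (Real.sqrt N) (F.eval (n : ℤ)).toNat : ℝ)) with hS
  set cf : ℕ → ℕ := fun n => Shiu.cPart (Real.sqrt N) (F.eval (n : ℤ)).toNat with hcf
  set Tset : ℕ → Finset ℕ := fun c => (Icc 1 N).filter fun n : ℕ => (c : ℤ) ∣ F.eval (n : ℤ) ∧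
      ∀ p ∈ Nat.primesBelow ⌈z₀⌉₊, ¬ p ∣ c → ¬ (p : ℤ) ∣ F.eval (n : ℤ) with hTset
  -- the value bound `m ≤ N^{d+1}`
  have hmN : ∀ n : ℕ, n ≤ N → ((F.eval (n : ℤ)).toNat : ℝ) ≤ (N : ℝ) ^ ((d : ℝ) + 1) := by
    intro n hn
    have h1 : (F.eval (n : ℤ)).toNat ≤ Hh * (N + 1) ^ d := toNat_eval_le_height hn
    have h2 : Hh * (N + 1) ^ d ≤ N ^ (d + 1) := by
      calc Hh * (N + 1) ^ d ≤ Hh * (2 * N) ^ d := Nat.mul_le_mul_left _ (Nat.pow_le_pow_left (by omega) _)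
        _ = Hh * 2 ^ d * N ^ d := by rw [mul_pow]; ring
        _ ≤ N * N ^ d := Nat.mul_le_mul_right _ hNH
        _ = N ^ (d + 1) := by ring
    calc ((F.eval (n : ℤ)).toNat : ℝ) ≤ ((N ^ (d + 1) : ℕ) : ℝ) := by exact_mod_cast h1.trans h2
      _ = (N : ℝ) ^ ((d : ℝ) + 1) := by rw [Nat.cast_pow, ← Real.rpow_natCast, Nat.cast_add, Nat.cast_one]
  -- (a) weights: `G(m) ≤ A^{B₂} G(c)` on `S`, and the fibre containment
  have hfacts : ∀ n ∈ S, G (F.eval (n : ℤ)).toNat ≤ A ^ B₂ * G (cf n) ∧ n ∈ Tset (cf n) ∧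
      1 ≤ cf n ∧ (cf n : ℝ) ≤ Real.sqrt N := by
    intro n hn
    rw [hS, Finset.mem_filter, Finset.mem_Icc] at hn
    obtain ⟨hnI, hsq, hzP⟩ := hn
    set m := (F.eval (n : ℤ)).toNat with hm
    have hmpos : 0 < F.eval (n : ℤ) := hpos n hnI.1
    obtain ⟨hm2, hZ1⟩ := two_le_of_sqrt_lt (show 1 ≤ N by omega) hsq
    obtain ⟨hPmem, hcZ, hZlt, hcd, hcop, hcprimes, hdprimes, hsmall⟩ := cut_facts hm2 hZ1 hsq
    set P := Shiu.cutPrime (Real.sqrt N) m with hPdef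
    have hP : P.Prime := Nat.prime_of_mem_primeFactors hPmem
    have hPz : z₀ ≤ P := hzP
    have hP1 : (1 : ℝ) < P := by linarith
    have hlogP : Real.log z₀ ≤ Real.log P := Real.log_le_log (by linarith) hPz
    refine ⟨?_, ?_, Nat.one_le_iff_ne_zero.2 Shiu.cPart_ne_zero, hcZ⟩
    · -- weight
      have h1 := weight_cut_le hG0 hG1 hGmul hGA hA hm2 hZ1 hsq
      have hratio : Real.log m / Real.log P ≤ B₂ := by
        rw [div_le_iff₀ (by linarith)]
        have h2 : Real.log m ≤ ((d : ℝ) + 1) * Real.log N := by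
          have hm0 : (0 : ℝ) < m := by exact_mod_cast (show 0 < m by omega)
          calc Real.log m ≤ Real.log ((N : ℝ) ^ ((d : ℝ) + 1)) := Real.log_le_log hm0 (hmN n hnI.2)
            _ = ((d : ℝ) + 1) * Real.log N := Real.log_rpow hN0 _
        calc Real.log m ≤ ((d : ℝ) + 1) * Real.log N := h2
          _ = B₂ * Real.log z₀ := by rw [hlogz₀, hB₂]; field_simp
          _ ≤ B₂ * Real.log P := mul_le_mul_of_nonneg_left hlogP hB₂0
      calc G m ≤ G (cf n) * A ^ (Real.log m / Real.log P) := h1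
        _ ≤ G (cf n) * A ^ B₂ := mul_le_mul_of_nonneg_left (Real.rpow_le_rpow_of_exponent_le hA hratio) (hG0 _)
        _ = A ^ B₂ * G (cf n) := mul_comm _ _
    · -- fibre containment
      rw [hTset, Finset.mem_filter, Finset.mem_Icc]
      refine ⟨hnI, ?_, ?_⟩
      · rw [← Int.toNat_of_nonneg hmpos.le]
        exact_mod_cast Shiu.cPart_dvd (show m ≠ 0 by omega)
      · intro p hp hpc hpF
        rw [Nat.mem_primesBelow] at hp
        have hpz : (p : ℝ) < z₀ := (Nat.lt_ceil).1 hp.1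
        have hpP : p < P := by exact_mod_cast hpz.trans_le hPz
        have hpm : p ∣ m := by
          rw [← Int.toNat_of_nonneg hmpos.le] at hpF
          exact_mod_cast hpF
        exact hpc (hsmall p hp.2 hpP hpm)
  -- (b) Σ_S G(m) ≤ A^{B₂} Σ_{c ∈ Icc 1 ⌊√N⌋} G(c) #Tset(c)
  have hstep1 : ∑ n ∈ S, G (F.eval (n : ℤ)).toNat ≤
      A ^ B₂ * ∑ c ∈ Icc 1 ⌊Real.sqrt N⌋₊, G c * #(Tset c) := by
    calc ∑ n ∈ S, G (F.eval (n : ℤ)).toNat ≤ ∑ n ∈ S, A ^ B₂ * G (cf n) :=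
          Finset.sum_le_sum fun n hn => (hfacts n hn).1
      _ = A ^ B₂ * ∑ n ∈ S, G (cf n) := by rw [Finset.mul_sum]
      _ = A ^ B₂ * ∑ c ∈ S.image cf, (#(S.filter fun n => cf n = c) : ℝ) * G c := by
          rw [Finset.sum_comp]
          simp only [nsmul_eq_mul]
      _ ≤ A ^ B₂ * ∑ c ∈ S.image cf, G c * #(Tset c) := by
          refine mul_le_mul_of_nonneg_left (Finset.sum_le_sum fun c hc => ?_) hApos.le
          rw [mul_comm]
          refine mul_le_mul_of_nonneg_left ?_ (hG0 c)
          exact_mod_cast Finset.card_le_card fun n hn => by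
            rw [Finset.mem_filter] at hn
            rw [← hn.2]; exact (hfacts n hn.1).2.1
      _ ≤ A ^ B₂ * ∑ c ∈ Icc 1 ⌊Real.sqrt N⌋₊, G c * #(Tset c) := by
          refine mul_le_mul_of_nonneg_left (Finset.sum_le_sum_of_subset_of_nonneg ?_ ?_) hApos.le
          · intro c hc
            rw [Finset.mem_image] at hc
            obtain ⟨n, hn, rfl⟩ := hc
            rw [Finset.mem_Icc]
            exact ⟨(hfacts n hn).2.2.1, Nat.le_floor (hfacts n hn).2.2.2⟩
          · intro c _ _; exact mul_nonneg (hG0 c) (Nat.cast_nonneg _)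
  -- (c) the engine sum
  have hstep2 := hcs G hG0 hG1 hGmul hGA N hN4 z₀ hz2 hz₀N (Icc 1 ⌊Real.sqrt N⌋₊) Finset.Subset.rfl
  -- (d) the main term
  set V : ℝ := ∏ p ∈ Nat.primesBelow ⌈z₀⌉₊, (1 - (polyRootCountMod ![F] p : ℝ) / p) with hVdef
  have hratio : Real.log N / Real.log z₀ = 1 / e₀ := by
    rw [hlogz₀]; field_simp
  have hVle : V ≤ K₅ * (1 / e₀) ^ D * Real.exp (-∑ p ∈ Nat.primesLE N, (polyRootCountMod ![F] p : ℝ) / p) := by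
    rw [hVdef, ← hratio]; exact hV N z₀ hz2 hz₀N
  have hEsplit : Real.exp (∑ p ∈ Nat.primesLE N, (G p - 1) * polyRootCountMod ![F] p / p) =
      Real.exp (∑ p ∈ Nat.primesLE N, G p * polyRootCountMod ![F] p / p) *
        Real.exp (-∑ p ∈ Nat.primesLE N, (polyRootCountMod ![F] p : ℝ) / p) := by
    rw [sum_sub_one_mul_eq, sub_eq_add_neg, Real.exp_add]
  have hUle := sum_u_div_le F hD hD1 hfix hM hM1 hG0 hG1 hGmul hGA hA ⌊Real.sqrt N⌋₊
  have hsqN : (⌊Real.sqrt N⌋₊ : ℕ) ≤ N := by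
    have : (⌊Real.sqrt N⌋₊ : ℝ) ≤ N := (Nat.floor_le (Real.sqrt_nonneg _)).trans
      (by rw [Real.sqrt_le_left (by linarith)]; nlinarith)
    exact_mod_cast this
  have hUle' : ∑ c ∈ Icc 1 ⌊Real.sqrt N⌋₊, G c * polyRootCountMod ![F] c *
      (∏ p ∈ c.primeFactors, (p : ℝ) / ((p : ℝ) - polyRootCountMod ![F] p)) / c ≤
      Real.exp (Kc + ∑ p ∈ Nat.primesLE N, G p * polyRootCountMod ![F] p / p) := by
    refine hUle.trans (Real.exp_le_exp.2 ?_)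
    have := sum_Grho_div_mono (F := F) hG0 ((show Nat.primesLE ⌊Real.sqrt N⌋₊ ⊆ Nat.primesLE N from fun p hp => by
      rw [Nat.mem_primesLE] at hp ⊢; exact ⟨hp.1.trans hsqN, hp.2⟩))
    linarith
  have hmain : K₁ * N * V * ∑ c ∈ Icc 1 ⌊Real.sqrt N⌋₊, G c * polyRootCountMod ![F] c *
        (∏ p ∈ c.primeFactors, (p : ℝ) / ((p : ℝ) - polyRootCountMod ![F] p)) / c ≤
      K₁ * K₅ * (1 / e₀) ^ D * Real.exp Kc * N *
        Real.exp (∑ p ∈ Nat.primesLE N, (G p - 1) * polyRootCountMod ![F] p / p) := by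
    have hsum0 : 0 ≤ ∑ c ∈ Icc 1 ⌊Real.sqrt N⌋₊, G c * polyRootCountMod ![F] c *
        (∏ p ∈ c.primeFactors, (p : ℝ) / ((p : ℝ) - polyRootCountMod ![F] p)) / c :=
      Finset.sum_nonneg fun c _ => by
        have := hG0 c
        have := one_le_hLoc F hD hfix c
        positivity
    calc K₁ * N * V * ∑ c ∈ Icc 1 ⌊Real.sqrt N⌋₊, G c * polyRootCountMod ![F] c *
          (∏ p ∈ c.primeFactors, (p : ℝ) / ((p : ℝ) - polyRootCountMod ![F] p)) / c
        ≤ K₁ * N * (K₅ * (1 / e₀) ^ D * Real.exp (-∑ p ∈ Nat.primesLE N, (polyRootCountMod ![F] p : ℝ) / p)) *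
          Real.exp (Kc + ∑ p ∈ Nat.primesLE N, G p * polyRootCountMod ![F] p / p) := by
          gcongr
      _ = K₁ * K₅ * (1 / e₀) ^ D * Real.exp Kc * N *
          Real.exp (∑ p ∈ Nat.primesLE N, (G p - 1) * polyRootCountMod ![F] p / p) := by
          rw [hEsplit, Real.exp_add]; ring
  -- (e) the remainder term
  set ℓ : ℝ := Real.log (Real.log N) with hℓ
  have hrem : K₂ * z₀ ^ (18 * D + 1) * Real.log z₀ ^ D *
        (Real.sqrt N * Real.exp (A * M + A * D * (Real.log (Real.log N) + 4))) ≤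
      K₂ * Real.exp (A * M + A * D * 4) * Real.exp (4 * D) * Real.exp (Bℓ * Real.log (Bℓ / (1 / 4) + 1)) * N *
        Real.exp (∑ p ∈ Nat.primesLE N, (G p - 1) * polyRootCountMod ![F] p / p) := by
    -- `z₀^{18D+1} = N^{1/4}`
    have hzE : z₀ ^ (18 * D + 1) = (N : ℝ) ^ (1 / 4 : ℝ) := by
      rw [hz₀, ← Real.rpow_natCast, ← Real.rpow_mul hN0.le]
      congr 1
      rw [he₀]; push_cast; field_simp
    -- `(log z₀)^D ≤ (log N)^D = exp(D log log N)`
    have hlz : Real.log z₀ ^ D ≤ Real.exp (D * Real.log (Real.log N)) := by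
      rw [Real.exp_nat_mul, Real.exp_log hlogN]
      exact pow_le_pow_left₀ hlogz₀pos.le (Real.log_le_log (by linarith) hz₀N) D
    have hsqrt : Real.sqrt N = (N : ℝ) ^ (1 / 2 : ℝ) := Real.sqrt_eq_rpow _
    have hll := exp_mul_loglog_le hN1 hBℓ0 (show (0 : ℝ) < 1 / 4 by norm_num)
    have hlow := exp_neg_le_exp_sum (F := F) hG0 hD (show 2 ≤ N by omega)
    -- LHS ≤ K₂ e^{AM+4AD} N^{3/4} exp((D + AD) ℓ)
    have hlhs : K₂ * z₀ ^ (18 * D + 1) * Real.log z₀ ^ D *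
        (Real.sqrt N * Real.exp (A * M + A * D * (ℓ + 4))) ≤
        K₂ * Real.exp (A * M + A * D * 4) * ((N : ℝ) ^ (3 / 4 : ℝ) * Real.exp ((D + A * D) * ℓ)) := by
      rw [hzE, hsqrt]
      have h1 : Real.exp (A * M + A * D * (ℓ + 4)) = Real.exp (A * M + A * D * 4) * Real.exp (A * D * ℓ) := by
        rw [← Real.exp_add]; ring_nf
      rw [h1]
      have h2 : (N : ℝ) ^ (1 / 4 : ℝ) * (N : ℝ) ^ (1 / 2 : ℝ) = (N : ℝ) ^ (3 / 4 : ℝ) := by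
        rw [← Real.rpow_add hN0]; norm_num
      have h3 : Real.exp (D * ℓ) * Real.exp (A * D * ℓ) = Real.exp ((D + A * D) * ℓ) := by
        rw [← Real.exp_add]; ring_nf
      calc K₂ * (N : ℝ) ^ (1 / 4 : ℝ) * Real.log z₀ ^ D *
            ((N : ℝ) ^ (1 / 2 : ℝ) * (Real.exp (A * M + A * D * 4) * Real.exp (A * D * ℓ)))
          ≤ K₂ * (N : ℝ) ^ (1 / 4 : ℝ) * Real.exp (D * ℓ) *
            ((N : ℝ) ^ (1 / 2 : ℝ) * (Real.exp (A * M + A * D * 4) * Real.exp (A * D * ℓ))) := by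
            gcongr
        _ = K₂ * Real.exp (A * M + A * D * 4) * (((N : ℝ) ^ (1 / 4 : ℝ) * (N : ℝ) ^ (1 / 2 : ℝ)) *
            (Real.exp (D * ℓ) * Real.exp (A * D * ℓ))) := by ring
        _ = K₂ * Real.exp (A * M + A * D * 4) * ((N : ℝ) ^ (3 / 4 : ℝ) * Real.exp ((D + A * D) * ℓ)) := by
            rw [h2, h3]
    refine hlhs.trans ?_
    -- N^{3/4} exp((D+AD)ℓ) = N^{3/4} exp(Bℓ ℓ) exp(−D ℓ) ≤ Cℓ N exp(−Dℓ) ≤ Cℓ e^{4D} N exp(Σ (G−1)ρ/p)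
    have h4 : (N : ℝ) ^ (3 / 4 : ℝ) * Real.exp ((D + A * D) * ℓ) ≤
        Real.exp (4 * D) * Real.exp (Bℓ * Real.log (Bℓ / (1 / 4) + 1)) * N *
          Real.exp (∑ p ∈ Nat.primesLE N, (G p - 1) * polyRootCountMod ![F] p / p) := by
      have h5 : Real.exp ((D + A * D) * ℓ) = Real.exp (Bℓ * ℓ) * Real.exp (-(D * ℓ)) := by
        rw [← Real.exp_add, hBℓ]; ring_nf
      have h6 : Real.exp (-(D * ℓ)) = Real.exp (4 * D) * Real.exp (-(D * (ℓ + 4))) := by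
        rw [← Real.exp_add]; ring_nf
      calc (N : ℝ) ^ (3 / 4 : ℝ) * Real.exp ((D + A * D) * ℓ)
          = (N : ℝ) ^ (3 / 4 : ℝ) * Real.exp (Bℓ * ℓ) * Real.exp (-(D * ℓ)) := by rw [h5]; ring
        _ ≤ (N : ℝ) ^ (3 / 4 : ℝ) * (Real.exp (Bℓ * Real.log (Bℓ / (1 / 4) + 1)) * (N : ℝ) ^ (1 / 4 : ℝ)) *
            Real.exp (-(D * ℓ)) := by gcongr
        _ = Real.exp (Bℓ * Real.log (Bℓ / (1 / 4) + 1)) * ((N : ℝ) ^ (3 / 4 : ℝ) * (N : ℝ) ^ (1 / 4 : ℝ)) *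
            (Real.exp (4 * D) * Real.exp (-(D * (ℓ + 4)))) := by rw [h6]; ring
        _ = Real.exp (4 * D) * Real.exp (Bℓ * Real.log (Bℓ / (1 / 4) + 1)) * N *
            Real.exp (-(D * (ℓ + 4))) := by rw [← Real.rpow_add hN0]; norm_num; ring
        _ ≤ Real.exp (4 * D) * Real.exp (Bℓ * Real.log (Bℓ / (1 / 4) + 1)) * N *
            Real.exp (∑ p ∈ Nat.primesLE N, (G p - 1) * polyRootCountMod ![F] p / p) := by gcongr
    calc K₂ * Real.exp (A * M + A * D * 4) * ((N : ℝ) ^ (3 / 4 : ℝ) * Real.exp ((D + A * D) * ℓ))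
        ≤ K₂ * Real.exp (A * M + A * D * 4) * (Real.exp (4 * D) * Real.exp (Bℓ * Real.log (Bℓ / (1 / 4) + 1)) * N *
          Real.exp (∑ p ∈ Nat.primesLE N, (G p - 1) * polyRootCountMod ![F] p / p)) :=
          mul_le_mul_of_nonneg_left h4 (by positivity)
      _ = _ := by ring
  -- (f) assemble
  calc ∑ n ∈ S, G (F.eval (n : ℤ)).toNat
      ≤ A ^ B₂ * ∑ c ∈ Icc 1 ⌊Real.sqrt N⌋₊, G c * #(Tset c) := hstep1
    _ ≤ A ^ B₂ * (K₁ * N * V * ∑ c ∈ Icc 1 ⌊Real.sqrt N⌋₊, G c * polyRootCountMod ![F] c *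
          (∏ p ∈ c.primeFactors, (p : ℝ) / ((p : ℝ) - polyRootCountMod ![F] p)) / c +
        K₂ * z₀ ^ (18 * D + 1) * Real.log z₀ ^ D *
          (Real.sqrt N * Real.exp (A * M + A * D * (ℓ + 4)))) :=
        mul_le_mul_of_nonneg_left hstep2 hApos.le
    _ ≤ A ^ B₂ * (K₁ * K₅ * (1 / e₀) ^ D * Real.exp Kc * N *
          Real.exp (∑ p ∈ Nat.primesLE N, (G p - 1) * polyRootCountMod ![F] p / p) +
        K₂ * Real.exp (A * M + A * D * 4) * Real.exp (4 * D) * Real.exp (Bℓ * Real.log (Bℓ / (1 / 4) + 1)) * N *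
          Real.exp (∑ p ∈ Nat.primesLE N, (G p - 1) * polyRootCountMod ![F] p / p)) :=
        mul_le_mul_of_nonneg_left (add_le_add hmain hrem) hApos.le
    _ = (C₁ + C₂) * N * Real.exp (∑ p ∈ Nat.primesLE N, (G p - 1) * polyRootCountMod ![F] p / p) := by
        rw [hC₁, hC₂]; ring

end Main

/-- **Registered form** (`--supports stmt-Parity-11292`): the `c`-sum through the engine and class I. [folklore] -/
theorem nair_class1_le : ∀ (F : ℤ[X]) (D M : ℕ) (A : ℝ), 1 ≤ F.natDegree → (∀ n : ℕ, 1 ≤ n → 0 < F.eval (n : ℤ)) → (∀ p : ℕ, p.Prime → polyRootCountMod ![F] p ≤ D) → 1 ≤ D → (∀ p : ℕ, p.Prime → polyRootCountMod ![F] p < p) → (∀ p : ℕ, p.Prime → ∀ a : ℕ, 1 ≤ a → polyRootCountMod ![F] (p ^ a) ≤ M) → 1 ≤ M → 1 ≤ A → ∃ C : ℝ, 0 < C ∧ ∃ N₀ : ℕ, ∀ G : ℕ → ℝ, (∀ n, 0 ≤ G n) → G 1 = 1 → (∀ m n : ℕ, m.Coprime n → G (m * n) = G m * G n) → (∀ p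 : ℕ, p.Prime → ∀ v : ℕ, 1 ≤ v → G (p ^ v) ≤ A) → ∀ N : ℕ, N₀ ≤ N → ∑ n ∈ (Icc 1 N).filter (fun n : ℕ => Real.sqrt N < (F.eval (n : ℤ)).toNat ∧ (N : ℝ) ^ (1 / (4 * (18 * (D : ℝ) + 1))) ≤ (Shiu.cutPrime (Real.sqrt N) (F.eval (n : ℤ)).toNat : ℝ)), G (F.eval (n : ℤ)).toNat ≤ C * N * Real.exp (∑ p ∈ Nat.primesLE N, (G p - 1) * polyRootCountMod ![F] p / p) :=
  fun _F _D _M _A hd hpos hD hD1 hfix hM hM1 hA => class1_le hd hpos hD hD1 hfix hM hM1 hA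

end

end Summit.Parity.BatemanHorn.Cruxes.SystemLSDRealSegment.BetaThinnedRootKernel.Nair
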